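import Summits.QuantumFields.QCD.Theorems.QuarksAsStableActionStableActionBridgeWilsonTransferForm
import Summits.QuantumFields.QCD.Theorems.QuarksAsStableActionStableActionBridgeAPDetTransferForm
import Summits.QuantumFields.QCD.Theorems.QuarksAsStableActionStableActionBridgeFockLiftPosDef
import Summits.QuantumFields.QCD.Theorems.QuarksAsStableActionStableActionBridgeSliceSpin
import Summits.QuantumFields.QCD.Theorems.QuarksAsStableActionStableActionBridgeProjChainDet
import Summits.QuantumFields.QCD.Theorems.QuarksAsStableActionWilsonQuarkStabilityStubStaticSliceBoundAux
import Literature.MathematicalPhysics.QuantumLattice.WilsonDiracAP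

/-!
# Stub `stub_staticSliceBoundAllN` of line `registered`
(crux `Summit.QuantumFields.QCD.Theses.WilsonQuarkChessboard.FlatCellOptimal`, item stmt-QuantumFields-9307)

**The static slice bound in the time direction, for every colour number `N`.**  For every `U(N)` field `V` on
`(ℤ/L)⁴` (`L ≥ 1`) and `m > −1`, `‖det D_W[V]‖^L ≤ ∏_s ‖det D_W[S⁰_s V]‖`, where `D_W[X] = wilsonDirac ρ_N X m 1`
is the `r = 1` Wilson–Dirac operator and the STATIC field `S⁰_s V` keeps the spatial links of slice `x₀ = s` of `V`
on every slice and has temporal links `1`, except `−1` on the seam `x₀ = −1` (the antiperiodic pattern) — GIVEN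
the cyclic Hölder / chessboard inequality `‖Tr ∏_{i<L} T_i u_i‖^L ≤ ∏_i Re Tr T_i^L` (hypothesis `hH`, stub
`stub_cyclicHolderEven`) and the blindness of the chain-block determinant to the temporal links (hypothesis `hE`,
stub `stub_normDetChainBlock`).

This is a port of the tree theorem `stub_staticSliceBound` (crux stmt-QuantumFields-9736, colour group `U(3)`):
the colour index `Fin 3` becomes `Fin N` throughout, and the unused hypothesis `Odd L` of the 9736 signature is
dropped (oddness/evenness of `L` only enters the proof of `hH`).  The engine (`wilson_det_transfer_form`,
`wilsonSlice_spin_structure`, `WilsonTransfer.slice_claims`, the `StaticSliceBound` auxiliary lemmas) is already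
stated for an arbitrary colour number.

Proof.  Lüscher's transfer-matrix form (`wilson_det_transfer_form`, p120730) gives
`det D_W[V] = (∏_t det (A_t P⁻ − P⁺ W′_{t−1})) · det (1 − ∏_{i<L} M_i W_i)` with `M_t > 0` a function of the spatial
links of slice `t` only and `W_t, W′_t = W_tᴴ` the unitary temporal transporters commuting with `P±`
(`wilsonSlice_spin_structure`, `slice_claims`).  By `hE`, `‖det (A_t P⁻ − P⁺ W′_{t−1})‖ = ‖det (A_t P⁻ − P⁺)‖`.
By `hH` on Fock space (`StaticSliceBound.det_one_sub_prod_pow_le`: `T_t = Γ(M_t)`, `u_t = Γ(±W_t)`,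
`Tr Γ(X) = det (1 + X)`), `‖det (1 − ∏ M_i W_i)‖^L ≤ ∏_s Re det (1 + M_s^L)`.  For the static field `S⁰_s V`
the same formula has `A_t ≡ A_s`, `M_t ≡ M_s`, `W_t = W′_t = 1` off the seam and `−1` on it, so
`‖det D_W[S⁰_s V]‖ = ‖det (A_s P⁻ − P⁺)‖^L · Re det (1 + M_s^L)`
(`StaticSliceBoundAllN.norm_det_wilsonDirac_static_allN`); multiplying over `s` assembles the bound.
Pure theorem file (no definitions).
References: Lüscher, Commun. Math. Phys. 54 (1977) 283; Smit, *Introduction to Quantum Fields on a Lattice*, §6.5.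
-/

namespace Summit.QuantumFields.QCD.Cruxes.FlatCellOptimal.Diamag

open Literature.MathematicalPhysics Literature.MathematicalPhysics.QuantumLattice
  Literature.MathematicalPhysics.QuantumFieldTheory
open Literature.Probability.LatticeModels (TorusSite)
open Matrix Complex
open scoped ComplexOrder
open Summit.QuantumFields.QCD.Cruxes.StableActionBridge.Sketch
open Summit.QuantumFields.QCD.Cruxes.WilsonQuarkStability.FreeTangentLandauChessboard.StaticSliceBound

noncomputable section

namespace StaticSliceBoundAllN

/-- **The Wilson determinant of a static `U(N)` field.**  For the static field `S⁰_s V` (spatial links of slice `s`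
of `V` on every slice, temporal links `1` off the seam and `−1` on the seam `x₀ = −1`), in terms of Lüscher's
transfer data `P±, A_t, M_t` of `V` (the `let`s, verbatim from `wilson_det_transfer_form`):
`‖det D_W[S⁰_s V]‖ = ‖det (A_s P⁻ − P⁺)‖ ^ L · Re det (1 + M_s ^ L)`, given the chain-block lemma `hE`
(port of `StaticSliceBound.norm_det_wilsonDirac_static`, colour `Fin 3 ↦ Fin N`). -/
theorem norm_det_wilsonDirac_static_allN {N L : ℕ} [NeZero L]
    (hE : ∀ {k : Type} [Fintype k] [DecidableEq k] (A Pp Pm W : Matrix k k ℂ),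
      Pp + Pm = 1 → Pp * Pm = 0 → Pm * Pp = 0 → Ppᴴ = Pp → Pmᴴ = Pm →
      W ∈ Matrix.unitaryGroup k ℂ → W * Pp = Pp * W → W * Pm = Pm * W →
      ‖(A * Pm - Pp * W).det‖ = ‖(A * Pm - Pp).det‖)
    (V : GaugeConfig 4 L (Matrix.unitaryGroup (Fin N) ℂ)) (m : ℝ) (hm : -1 < m) (s : ZMod L) :
    let Pp : Matrix (TorusSite 3 L × Fin N × Fin 4) (TorusSite 3 L × Fin N × Fin 4) ℂ := Matrix.of fun a b =>
      if a.1 = b.1 ∧ a.2.1 = b.2.1 then ((1 / 2 : ℂ) • (1 + euclideanGamma 0)) a.2.2 b.2.2 else 0;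
    let Pm : Matrix (TorusSite 3 L × Fin N × Fin 4) (TorusSite 3 L × Fin N × Fin 4) ℂ := Matrix.of fun a b =>
      if a.1 = b.1 ∧ a.2.1 = b.2.1 then ((1 / 2 : ℂ) • (1 - euclideanGamma 0)) a.2.2 b.2.2 else 0;
    let A : ZMod L → Matrix (TorusSite 3 L × Fin N × Fin 4) (TorusSite 3 L × Fin N × Fin 4) ℂ := fun t =>
      Matrix.of fun a b =>
        (if a = b then ((m + 4 * 1 : ℝ) : ℂ) else 0) -
          (1 / 2 : ℂ) * ∑ j : Fin 3,
            ((if b.1 = Literature.MathematicalPhysics.QuantumFieldTheory.Site.shift a.1 j then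
                (((1 : ℝ) : ℂ) • (1 : Matrix (Fin 4) (Fin 4) ℂ) - euclideanGamma j.succ) a.2.2 b.2.2 *
                  unitaryFundamentalRep (Fin N) ℂ (V ((Fin.cons t a.1 : TorusSite 4 L), j.succ)) a.2.1 b.2.1 else 0) +
              (if a.1 = Literature.MathematicalPhysics.QuantumFieldTheory.Site.shift b.1 j then
                (((1 : ℝ) : ℂ) • (1 : Matrix (Fin 4) (Fin 4) ℂ) + euclideanGamma j.succ) a.2.2 b.2.2 *
                  unitaryFundamentalRep (Fin N) ℂ (V ((Fin.cons t b.1 : TorusSite 4 L), j.succ))⁻¹ a.2.1 b.2.1 else 0));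
    let B : ZMod L → Matrix (TorusSite 3 L × Fin N) (TorusSite 3 L × Fin N) ℂ := fun t => Matrix.of fun a b =>
        (if a = b then ((m + 4 : ℝ) : ℂ) else 0) -
          (1 / 2 : ℂ) * ∑ j : Fin 3,
            ((if b.1 = Literature.MathematicalPhysics.QuantumFieldTheory.Site.shift a.1 j then
                unitaryFundamentalRep (Fin N) ℂ (V ((Fin.cons t a.1 : TorusSite 4 L), j.succ)) a.2 b.2 else 0) +
              (if a.1 = Literature.MathematicalPhysics.QuantumFieldTheory.Site.shift b.1 j then
                unitaryFundamentalRep (Fin N) ℂ (V ((Fin.cons t b.1 : TorusSite 4 L), j.succ))⁻¹ a.2 b.2 else 0));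
    let Bh : ZMod L → Matrix (TorusSite 3 L × Fin N × Fin 4) (TorusSite 3 L × Fin N × Fin 4) ℂ := fun t =>
      Matrix.of fun a b => if a.2.2 = b.2.2 then B t (a.1, a.2.1) (b.1, b.2.1) else 0;
    let M : ZMod L → Matrix (TorusSite 3 L × Fin N × Fin 4) (TorusSite 3 L × Fin N × Fin 4) ℂ := fun t =>
      (1 + Pp * (A t - Bh t) * Pm) * (Bh t * Pp + (Bh t)⁻¹ * Pm) * (1 - Pm * (A t - Bh t) * Pp);
    ‖(wilsonDirac (unitaryFundamentalRep (Fin N) ℂ)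
        (fun e : Edge 4 L => if e.2 = 0 then (if e.1 0 = -1 then (-1 : Matrix.unitaryGroup (Fin N) ℂ) else 1)
          else V (Function.update e.1 0 s, e.2)) m 1).det‖ =
      ‖(A s * Pm - Pp).det‖ ^ L * ((1 + M s ^ L).det).re := by
  intro Pp Pm A B Bh M
  set S : GaugeConfig 4 L (Matrix.unitaryGroup (Fin N) ℂ) := fun e : Edge 4 L =>
    if e.2 = 0 then (if e.1 0 = -1 then (-1 : Matrix.unitaryGroup (Fin N) ℂ) else 1)
      else V (Function.update e.1 0 s, e.2) with hSdef
  have hρ : ∀ g, unitaryFundamentalRep (Fin N) ℂ g ∈ Matrix.unitaryGroup (Fin N) ℂ :=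
    unitaryFundamentalRep_mem_unitaryGroup
  -- (1) Lüscher's formula for the static field; its `P±` coincide with those of `V` and are merged
  have h := wilson_det_transfer_form N L (Matrix.unitaryGroup (Fin N) ℂ) (unitaryFundamentalRep (Fin N) ℂ) hρ S m hm
  extract_lets WS WS' AS BS BhS MS at h
  -- (2) the links of the static field, slice by slice
  have hS_succ : ∀ (t : ZMod L) (y : TorusSite 3 L) (j : Fin 3),
      S ((Fin.cons t y : TorusSite 4 L), j.succ) = V ((Fin.cons s y : TorusSite 4 L), j.succ) := fun t y j => by
    simp only [hSdef, Fin.succ_ne_zero, if_false, Fin.update_cons_zero]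
  have hS_zero : ∀ (t : ZMod L) (y : TorusSite 3 L),
      S ((Fin.cons t y : TorusSite 4 L), 0) = if t = -1 then -1 else 1 := fun t y => by
    simp only [hSdef, if_true, Fin.cons_zero]
  -- (3) the transfer data of the static field are those of `V` at slice `s`
  have hA : ∀ t, AS t = A s := fun t =>
    sliceOp_congr (unitaryFundamentalRep (Fin N) ℂ) S V m t s (hS_succ t)
  have hB : ∀ t, BS t = B s := fun t =>
    sliceMassHop_congr (unitaryFundamentalRep (Fin N) ℂ) S V m t s (hS_succ t)
  have hBh : ∀ t, BhS t = Bh s := fun t => by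
    simp only [BhS, Bh]
    rw [hB t]
  have hM : ∀ t, MS t = M s := fun t => by
    simp only [MS, M]
    rw [hA t, hBh t]
  -- (4) its temporal transporters are the signs `1` (off the seam) and `-1` (on the seam `t = -1`)
  have hW : ∀ t, ((t ≠ -1 → WS t = 1) ∧ (t = -1 → WS t = -1)) ∧ (WS' t = 1 ∨ WS' t = -1) := fun t => by
    by_cases ht : t = -1
    · have h1 : ∀ y : TorusSite 3 L, S ((Fin.cons t y : TorusSite 4 L), 0) = -1 := fun y => by
        rw [hS_zero, if_pos ht]
      have hWt : WS t = -1 := (hop_eq_of_apply_eq (unitaryFundamentalRep (Fin N) ℂ) S t (-1) h1).trans (by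
        rw [unitaryFundamentalRep_apply, Unitary.coe_neg, OneMemClass.coe_one]; exact colourLift_neg_one _ _)
      have hW't : WS' t = -1 := (hopInv_eq_of_apply_eq (unitaryFundamentalRep (Fin N) ℂ) S t (-1) h1).trans (by
        rw [unitary_neg_one_inv, unitaryFundamentalRep_apply, Unitary.coe_neg, OneMemClass.coe_one]
        exact colourLift_neg_one _ _)
      exact ⟨⟨fun h => absurd ht h, fun _ => hWt⟩, Or.inr hW't⟩
    · have h1 : ∀ y : TorusSite 3 L, S ((Fin.cons t y : TorusSite 4 L), 0) = 1 := fun y => by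
        rw [hS_zero, if_neg ht]
      have hWt : WS t = 1 := (hop_eq_of_apply_eq (unitaryFundamentalRep (Fin N) ℂ) S t 1 h1).trans (by
        rw [map_one]; exact colourLift_one _ _)
      have hW't : WS' t = 1 := (hopInv_eq_of_apply_eq (unitaryFundamentalRep (Fin N) ℂ) S t 1 h1).trans (by
        rw [inv_one, map_one]; exact colourLift_one _ _)
      exact ⟨⟨fun _ => hWt, fun h => absurd h ht⟩, Or.inl hW't⟩
  -- (5) the projections
  have hP : Pp + Pm = 1 := liftProjPlus_add_liftProjMinus (TorusSite 3 L) N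
  have hPQ : Pp * Pm = 0 := liftProjPlus_mul_liftProjMinus (TorusSite 3 L) N
  have hQP : Pm * Pp = 0 := liftProjMinus_mul_liftProjPlus (TorusSite 3 L) N
  have hPph : Ppᴴ = Pp := (WilsonTransfer.slice_claims (unitaryFundamentalRep (Fin N) ℂ) hρ V m hm s).2.2.1
  have hPmh : Pmᴴ = Pm := (WilsonTransfer.slice_claims (unitaryFundamentalRep (Fin N) ℂ) hρ V m hm s).2.2.2.1
  -- (6) the chain blocks of the static field (hypothesis `hE` with the sign transporter `W = ±1`)
  have hblock : ∀ t, ‖(AS t * Pm - Pp * WS' (t - 1)).det‖ = ‖(A s * Pm - Pp).det‖ := fun t => by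
    obtain ⟨hu, hcp⟩ := sign_unitary_comm (WS' (t - 1)) Pp (hW (t - 1)).2
    obtain ⟨-, hcm⟩ := sign_unitary_comm (WS' (t - 1)) Pm (hW (t - 1)).2
    rw [hA t]
    exact hE (A s) Pp Pm (WS' (t - 1)) hP hPQ hQP hPph hPmh hu hcp hcm
  -- (7) the Fock factor of the static field: `∏_{i<L} M_s W_i = -(M_s ^ L)`
  have hprod : ((List.range L).map fun i : ℕ => MS (i : ZMod L) * WS (i : ZMod L)).prod = -(M s ^ L) := by
    have : (fun i : ℕ => MS (i : ZMod L) * WS (i : ZMod L)) = fun i : ℕ => M s * WS (i : ZMod L) :=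
      funext fun i => by rw [hM]
    rw [this]
    exact prod_map_range_sign (M s) WS (fun t => (hW t).1.1) (fun t => (hW t).1.2)
  -- (8) assemble
  obtain ⟨hdet, hMpos⟩ := h
  have hMs : (M s).PosDef := hM 0 ▸ hMpos 0
  rw [hdet, norm_mul, norm_prod, Finset.prod_congr rfl fun t _ => hblock t, Finset.prod_const, Finset.card_univ,
    ZMod.card, hprod, sub_neg_eq_add, norm_det_one_add_pow hMs]

end StaticSliceBoundAllN

open StaticSliceBoundAllN in
/-- **Stub `stub_staticSliceBoundAllN` of line `registered`: the static slice bound in the time direction, for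
every colour number `N`.**  For every `U(N)` field `V` on `(ℤ/L)⁴` (`L ≠ 0`) and every `m > −1`,
`‖det D_W[V]‖^L ≤ ∏_s ‖det D_W[S⁰_s V]‖`, where `S⁰_s V` keeps the spatial links of slice `x₀ = s` on every slice
and has temporal links `1` except `−1` on the seam `x₀ = −1`; from Lüscher's transfer-matrix form
`wilson_det_transfer_form`, the Fock functor, the cyclic Hölder inequality `hH` (stub `stub_cyclicHolderEven`) and
the chain-block lemma `hE` (stub `stub_normDetChainBlock`).  Port of `stub_staticSliceBound` (crux 9736) with
colour `Fin 3 ↦ Fin N` and the unused `Odd L` dropped. -/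
theorem stub_staticSliceBoundAllN :
    ∀ (N L : ℕ) [NeZero L],
      (∀ {k : Type} [Fintype k] [DecidableEq k] (T u : ZMod L → Matrix k k ℂ),
        (∀ i, (T i).PosDef) → (∀ i, u i ∈ Matrix.unitaryGroup k ℂ) →
        ‖((List.range L).map fun i : ℕ => T (i : ZMod L) * u (i : ZMod L)).prod.trace‖ ^ L ≤
          ∏ i : ZMod L, ((T i) ^ L).trace.re) →
      (∀ {k : Type} [Fintype k] [DecidableEq k] (A Pp Pm W : Matrix k k ℂ),
        Pp + Pm = 1 → Pp * Pm = 0 → Pm * Pp = 0 → Ppᴴ = Pp → Pmᴴ = Pm →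
        W ∈ Matrix.unitaryGroup k ℂ → W * Pp = Pp * W → W * Pm = Pm * W →
        ‖(A * Pm - Pp * W).det‖ = ‖(A * Pm - Pp).det‖) →
      ∀ (V : GaugeConfig 4 L (Matrix.unitaryGroup (Fin N) ℂ)) (m : ℝ), -1 < m →
        ‖(wilsonDirac (unitaryFundamentalRep (Fin N) ℂ) V m 1).det‖ ^ L ≤
          ∏ s : ZMod L, ‖(wilsonDirac (unitaryFundamentalRep (Fin N) ℂ)
            (fun e : Edge 4 L => if e.2 = 0 then (if e.1 0 = -1 then (-1 : Matrix.unitaryGroup (Fin N) ℂ) else 1)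
              else V (Function.update e.1 0 s, e.2)) m 1).det‖ := by
  intro N L _ hH hE V m hm
  have hρ : ∀ g, unitaryFundamentalRep (Fin N) ℂ g ∈ Matrix.unitaryGroup (Fin N) ℂ :=
    unitaryFundamentalRep_mem_unitaryGroup
  -- (1) Lüscher's transfer-matrix form for `V`
  have hV := wilson_det_transfer_form N L (Matrix.unitaryGroup (Fin N) ℂ) (unitaryFundamentalRep (Fin N) ℂ) hρ V m hm
  extract_lets Pp Pm W W' A B Bh M at hV
  obtain ⟨hdet, hMpos⟩ := hV
  -- (2) the projections
  have hP : Pp + Pm = 1 := liftProjPlus_add_liftProjMinus (TorusSite 3 L) N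
  have hPQ : Pp * Pm = 0 := liftProjPlus_mul_liftProjMinus (TorusSite 3 L) N
  have hQP : Pm * Pp = 0 := liftProjMinus_mul_liftProjPlus (TorusSite 3 L) N
  have hPph : Ppᴴ = Pp := (WilsonTransfer.slice_claims (unitaryFundamentalRep (Fin N) ℂ) hρ V m hm 0).2.2.1
  have hPmh : Pmᴴ = Pm := (WilsonTransfer.slice_claims (unitaryFundamentalRep (Fin N) ℂ) hρ V m hm 0).2.2.2.1
  -- (3) the temporal transporters: unitary (`W′ᴴ = W`, `W′ W = 1`), commuting with the projections
  have hsp := fun t : ZMod L =>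
    wilsonSlice_spin_structure N L (Matrix.unitaryGroup (Fin N) ℂ) (unitaryFundamentalRep (Fin N) ℂ) V m t
  have hW'p : ∀ t, W' t * Pp = Pp * W' t := fun t => (hsp t).2.2.2.2.2.2.1
  have hW'm : ∀ t, W' t * Pm = Pm * W' t := fun t => (hsp t).2.2.2.2.2.2.2.1
  have hW'W : ∀ t, W' t * W t = 1 := fun t => (hsp t).2.2.2.2.2.2.2.2
  have hstar : ∀ t, star (W' t) = W t := fun t => by
    rw [star_eq_conjTranspose]
    exact conjTranspose_hopInv (unitaryFundamentalRep (Fin N) ℂ) hρ V t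
  have hW'u : ∀ t, W' t ∈ Matrix.unitaryGroup _ ℂ := fun t =>
    Matrix.mem_unitaryGroup_iff.mpr (by rw [hstar, hW'W])
  have hWu : ∀ t, W t ∈ Matrix.unitaryGroup _ ℂ := fun t => by
    rw [← hstar]
    exact Unitary.star_mem (hW'u t)
  -- (4) chain blocks (`hE`), the Hölder step on Fock space (`hH`), and the static fields
  have hEV : ∀ t, ‖(A t * Pm - Pp * W' (t - 1)).det‖ = ‖(A t * Pm - Pp).det‖ := fun t =>
    hE (A t) Pp Pm (W' (t - 1)) hP hPQ hQP hPph hPmh (hW'u _) (hW'p _) (hW'm _)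
  have hH' := det_one_sub_prod_pow_le hH M W hMpos hWu
  have hstat : ∀ s : ZMod L, ‖(wilsonDirac (unitaryFundamentalRep (Fin N) ℂ)
      (fun e : Edge 4 L => if e.2 = 0 then (if e.1 0 = -1 then (-1 : Matrix.unitaryGroup (Fin N) ℂ) else 1)
        else V (Function.update e.1 0 s, e.2)) m 1).det‖ =
      ‖(A s * Pm - Pp).det‖ ^ L * ((1 + M s ^ L).det).re := fun s =>
    norm_det_wilsonDirac_static_allN hE V m hm s
  -- (5) assembly
  rw [hdet, norm_mul, norm_prod, mul_pow, Finset.prod_congr rfl fun t _ => hEV t,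
    Finset.prod_congr rfl fun s _ => hstat s, Finset.prod_mul_distrib, Finset.prod_pow]
  exact mul_le_mul_of_nonneg_left hH' (pow_nonneg (Finset.prod_nonneg fun _ _ => norm_nonneg _) _)

end

end Summit.QuantumFields.QCD.Cruxes.FlatCellOptimal.Diamag
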